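import Literature.NumberTheory.IwasawaTheory.ClassicalMuVanishesQuadraticAscent
import HarnessLib

/-!
# Iwasawa's `μ = 0` ASCENDS a cyclic extension of ODD prime degree `p` along a `ℤ_p`-tower with boundedly many ramified
# primes (Iwasawa 1973, Theorem 2 at odd `ℓ`; proved, no definition, no named fact)

`Proofs`-style file (theorems only) in topic `NumberTheory/IwasawaTheory` (namespace `Literature.NumberTheory.IwasawaTheory`),
written by the prover seat `bsd-potss-rkm` g42 (cell `bsd-potss`; crux M = item stmt-BirchSwinnertonDyer-19196
`ReducibleKatoMember`; library pass — no K9/KT row consumes it, see HONEST SCOPE).  The ODD-`ℓ` twin of bsd-2adic's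
`ClassicalMuVanishesQuadraticAscent.lean` (`ℓ = 2`, quadratic steps with real places): the tree held the per-layer
Chevalley inequality for odd `p` (`AmbiguousClass.padicValNat_card_fixed_add_one_le_of_odd`) and the group-theoretic rank
module (`CyclicRankBound.padicValNat_card_quotient_le_of_fixed`), whose docstrings announce the odd case («`c = t − 1` for
`p` odd»), but not the assembled theorem (`FineSelmerPExtensionDescentProofs`: «Iwasawa 1973 ascent NOT used»).

THE THEOREM (`classicalMuVanishes_restrict_of_isGalois_of_finrank_eq_of_odd`).  `K` a number field, `p` an ODD prime,
`κ` a `ℤ_p`-extension of `K` (layers `K_n = κ.layer n ⊆ K̄`), `K'/K` a GALOIS extension of degree `p` (cyclic), linearly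
disjoint from `K_∞` (`κ ∘ res_{K'/K}` onto), `j' : K' → K̄` a `K`-embedding; the `n`-th layer of the restricted tower
`κ|_{K'}` is (`ClassicalMuVanishesSubextension`) the compositum `B_n = j'(K')·K_n ⊇ A_n = K_n`, a cyclic extension of number
fields of degree `p`, Galois because `K_n/K` and `j'(K')/K` are (`§1`).  HYPOTHESIS: for every `n` at most `T` primes of
`K_n` ramify in `B_n`.  CONCLUSION: `ClassicalMuVanishes κ ⟹ ClassicalMuVanishes (κ|_{K'})` (growth form of `μ = 0`).

PROOF (finite level, no `Λ`-modules, exactly Iwasawa's): `μ(κ) = 0` bounds `rank_p Cl(K_n) ≤ R` (tree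
`exists_forall_classGroupPRank_le_of_classicalMuVanishes`); per layer Chevalley's ambiguous class number formula for the
cyclic degree-`p` extension `B_n/K_n` — with NO archimedean term since `p` is odd — gives `ord_p #Cl(B_n)^G + 1 ≤
ord_p h(K_n) + T`; the module (G) (`N ∘ i = p`, extended classes are ambiguous, `(σ − 1)^p ≡ 0` on the `p`-torsion) turns
this into `rank_p Cl(B_n) ≤ p · (2R + T)`; bounded `p`-ranks give `μ(κ|_{K'}) = 0` (tree
`classicalMuVanishes_of_forall_classGroupPRank_le`).

* §1 `isGalois_layer_fieldRange_sup_layer` — `B_n/K_n` is Galois; `finrank_layer_fieldRange_sup_layer` — `[B_n : K_n] = [K' : K]`;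
  `iterate_mulEquiv_intAut_eq_pow` — the action of `σ^k` on `Cl(B_n)` is the `k`-th iterate.
* §2 **`classicalMuVanishes_restrict_of_isGalois_of_finrank_eq_of_odd`** (and the rank form
  `classGroupPRank_restrict_le_of_isGalois_of_finrank_eq_of_odd`: `rank_p Cl(B_n) ≤ p · (2·rank_p Cl(K_n) + T)` per layer,
  with no `μ`-hypothesis).

HONEST SCOPE.  Elementary (Chevalley + counting); the hypothesis «at most `T` ramified primes per layer» is the finite
decomposition of the ramified primes in the tower, to be discharged by the user (over `ℚ`: the sequel file).  The statement is
about Iwasawa's `μ` of the CLASS GROUP tower only; nothing about elliptic curves, Selmer groups or BSD is asserted; for the cell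
`bsd-potss` this is a LIBRARY pass: the `μ`-inputs of crux M's per-row doors live on fields of degree `∣ p − 1` and are NOT
`p`-extensions, so no K9/KT row consumes this file.

References: [Iwasawa1973MuInvariants] K. Iwasawa, *On the μ-invariants of ℤ_ℓ-extensions* (1973), Thm. 2 (cyclic of degree
`ℓ`), §2 (the proof: ambiguous classes, then `(σ−1)`-filtration); [Washington1997] §13.3 Prop. 13.23 (`μ = 0 ⟺` bounded
`p`-ranks); [Lang1990] Ch. 13 §4 Lemma 4.1–4.2 (Chevalley; no archimedean factor for odd degree); [NeukirchANT1999] Ch. III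
§1 Prop. (1.6) (ii), (iv) (`N ∘ i = [L:K]`, extended classes are invariant); [Gras2003] IV.4.
-/

set_option autoImplicit false

noncomputable section

open scoped NumberField Classical
open NumberField Field IntermediateField IsDedekindDomain

namespace Literature.NumberTheory.IwasawaTheory

open Literature.NumberTheory.EllipticCurves Literature.NumberTheory.EllipticCurves.ZpExtension
  Literature.NumberTheory.GaloisRepresentations Literature.NumberTheory.NumberFields
  Literature.NumberTheory.NumberFields.AmbiguousClass Literature.NumberTheory.NumberFields.CyclicRankBound

variable {K : Type} [Field K] [NumberField K] {p : ℕ} [Fact p.Prime]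

/-! ## §1 The layers `B_n = j'(K')·K_n ⊇ K_n`: Galois of degree `[K' : K]`; iterates of the class-group action -/

/-- **`B_n = j'(K')·K_n` is Galois over `K_n`** when `K'/K` is Galois: `j'(K') ≅ K'` and `K_n` are normal over `K`, hence so is
their compositum (Mathlib `IntermediateField.normal_sup`), and normality passes to the top of the tower `K ⊆ K_n ⊆ B_n`;
separability is automatic in characteristic `0`. [cite: Washington1997, §13.1 (the layers `K'K_n` of the restricted tower)] -/
theorem isGalois_layer_fieldRange_sup_layer (κ : ZpExtension K p) (K' : Type) [Field K'] [Algebra K K']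
    [FiniteDimensional K K'] [IsGalois K K'] (j' : K' →ₐ[K] AlgebraicClosure K) (n : ℕ) :
    letI : Algebra ↥(κ.layer n) ↥(j'.fieldRange ⊔ κ.layer n) :=
      (IntermediateField.inclusion (le_sup_right : κ.layer n ≤ j'.fieldRange ⊔ κ.layer n)).toRingHom.toAlgebra
    IsGalois ↥(κ.layer n) ↥(j'.fieldRange ⊔ κ.layer n) := by
  letI : Algebra ↥(κ.layer n) ↥(j'.fieldRange ⊔ κ.layer n) :=
    (IntermediateField.inclusion (le_sup_right : κ.layer n ≤ j'.fieldRange ⊔ κ.layer n)).toRingHom.toAlgebra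
  haveI : IsScalarTower K ↥(κ.layer n) ↥(j'.fieldRange ⊔ κ.layer n) := IsScalarTower.of_algebraMap_eq fun _ ↦ rfl
  haveI : IsGalois K ↥(κ.layer n) := κ.isGalois_layer_holds n
  haveI : Normal K ↥j'.fieldRange := Normal.of_algEquiv (AlgEquiv.ofInjectiveField j')
  haveI : Normal K ↥(j'.fieldRange ⊔ κ.layer n) := inferInstance
  haveI : Normal ↥(κ.layer n) ↥(j'.fieldRange ⊔ κ.layer n) := Normal.tower_top_of_normal K _ _
  haveI : FiniteDimensional K ↥j'.fieldRange := (AlgEquiv.ofInjectiveField j').toLinearEquiv.finiteDimensional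
  haveI : FiniteDimensional K ↥(κ.layer n) := κ.finiteDimensional_layer_holds n
  haveI : FiniteDimensional K ↥(j'.fieldRange ⊔ κ.layer n) := IntermediateField.finiteDimensional_sup _ _
  haveI : Algebra.IsSeparable K ↥(j'.fieldRange ⊔ κ.layer n) := inferInstance
  haveI : Algebra.IsSeparable ↥(κ.layer n) ↥(j'.fieldRange ⊔ κ.layer n) := Algebra.isSeparable_tower_top_of_isSeparable K _ _
  exact IsGalois.mk

/-- **`[B_n : K_n] = [K' : K]`** for `B_n = j'(K')·K_n` (`[B_n : K] = [K' : K]·pⁿ`, `[K_n : K] = pⁿ`; linear disjointness is the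
surjectivity `h`). [cite: Washington1997, §13.1] -/
theorem finrank_layer_fieldRange_sup_layer (κ : ZpExtension K p) (K' : Type) [Field K'] [NumberField K'] [Algebra K K']
    (h : Function.Surjective (κ.toContinuousMonoidHom.comp (absGaloisRestrict K K')))
    (j' : K' →ₐ[K] AlgebraicClosure K) (n : ℕ) :
    letI : Algebra ↥(κ.layer n) ↥(j'.fieldRange ⊔ κ.layer n) :=
      (IntermediateField.inclusion (le_sup_right : κ.layer n ≤ j'.fieldRange ⊔ κ.layer n)).toRingHom.toAlgebra
    Module.finrank ↥(κ.layer n) ↥(j'.fieldRange ⊔ κ.layer n) = Module.finrank K K' := by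
  letI : Algebra ↥(κ.layer n) ↥(j'.fieldRange ⊔ κ.layer n) :=
    (IntermediateField.inclusion (le_sup_right : κ.layer n ≤ j'.fieldRange ⊔ κ.layer n)).toRingHom.toAlgebra
  haveI : IsScalarTower K ↥(κ.layer n) ↥(j'.fieldRange ⊔ κ.layer n) := IsScalarTower.of_algebraMap_eq fun _ ↦ rfl
  haveI : FiniteDimensional K K' := Module.Finite.of_restrictScalars_finite ℚ K K'
  have hB : Module.finrank K ↥(j'.fieldRange ⊔ κ.layer n) = Module.finrank K K' * p ^ n :=
    finrank_fieldRange_sup_layer κ K' h j' n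
  have hA : Module.finrank K ↥(κ.layer n) = p ^ n := κ.finrank_layer_holds n
  have htower := Module.finrank_mul_finrank K ↥(κ.layer n) ↥(j'.fieldRange ⊔ κ.layer n)
  rw [hB, hA, mul_comm] at htower
  exact Nat.eq_of_mul_eq_mul_right (pow_pos (Fact.out : p.Prime).pos n) htower

/-- The action of `σ ^ k` on `Cl(L)` is the `k`-th iterate of that of `σ` (`σ ↦ Cl(σ)` is a homomorphism,
`mulEquiv_intAut_one` / `mulEquiv_intAut_mul`; the Galois action on ideal classes of Neukirch III (1.6) (iv)).
[cite: NeukirchANT1999, Ch. III §1 Prop. (1.6) (iv)] [cite: Iwasawa1973MuInvariants, §2 (the action of `σ` on the class group)] -/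
theorem iterate_mulEquiv_intAut_eq_pow {F L : Type} [Field F] [Field L] [NumberField L] [Algebra F L] (σ : L ≃ₐ[F] L)
    (k : ℕ) (b : ClassGroup (𝓞 L)) :
    (⇑(ClassGroup.mulEquiv (intAut σ)).toMonoidHom)^[k] b = ClassGroup.mulEquiv (intAut (σ ^ k)) b := by
  induction k with
  | zero => rw [Function.iterate_zero, pow_zero, mulEquiv_intAut_one]; rfl
  | succ k ih =>
    rw [Function.iterate_succ_apply', ih, MulEquiv.coe_toMonoidHom, ← MulEquiv.trans_apply, ← mulEquiv_intAut_mul,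
      ← pow_succ']

/-! ## §2 The ascent along a cyclic extension of odd prime degree -/

/-- **Per-layer rank bound (no `μ`-hypothesis)**: with the notation of the module docstring, for `p` odd, `K'/K` Galois of degree
`p` linearly disjoint from `K_∞`, and at most `T` primes of `K_n` ramified in `B_n = j'(K')·K_n`:
`rank_p Cl((K'K_∞)_n) ≤ p · (2 · rank_p Cl(K_n) + T)` (Chevalley for odd `p` + the `(σ − 1)`-filtration).
[cite: Iwasawa1973MuInvariants, Thm. 2 and its proof (§2)] [cite: Lang1990, Ch. 13 §4 Lemma 4.1–4.2]
[cite: NeukirchANT1999, Ch. III §1 Prop. (1.6) (ii), (iv)] -/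
theorem classGroupPRank_restrict_le_of_isGalois_of_finrank_eq_of_odd (hp : p ≠ 2) (κ : ZpExtension K p) (K' : Type)
    [Field K'] [NumberField K'] [Algebra K K'] [IsGalois K K'] (hdeg : Module.finrank K K' = p)
    (hK' : Function.Surjective (κ.toContinuousMonoidHom.comp (absGaloisRestrict K K')))
    (j' : K' →ₐ[K] AlgebraicClosure K) (n T : ℕ)
    (hram :
      letI : Algebra ↥(κ.layer n) ↥(j'.fieldRange ⊔ κ.layer n) :=
        (IntermediateField.inclusion (le_sup_right : κ.layer n ≤ j'.fieldRange ⊔ κ.layer n)).toRingHom.toAlgebra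
      {v : HeightOneSpectrum (𝓞 ↥(κ.layer n)) |
        v.asIdeal.ramificationIdxIn (𝓞 ↥(j'.fieldRange ⊔ κ.layer n)) ≠ 1}.ncard ≤ T) :
    classGroupPRank (κ.restrict K' hK') n ≤ p * (2 * classGroupPRank κ n + T) := by
  haveI : FiniteDimensional K K' := Module.Finite.of_restrictScalars_finite ℚ K K'
  have hpr : p.Prime := Fact.out
  -- the layers `A = K_n ⊆ B = j'(K')·K_n`
  set A : IntermediateField K (AlgebraicClosure K) := κ.layer n with hA
  set B : IntermediateField K (AlgebraicClosure K) := j'.fieldRange ⊔ κ.layer n with hB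
  have hAB : A ≤ B := le_sup_right
  haveI : FiniteDimensional K ↥A := κ.finiteDimensional_layer_holds n
  haveI : NumberField ↥A := NumberField.of_module_finite K ↥A
  haveI : NumberField ↥B := numberField_fieldRange_sup_layer κ K' j' n
  letI : Algebra ↥A ↥B := (IntermediateField.inclusion hAB).toRingHom.toAlgebra
  haveI : IsScalarTower K ↥A ↥B := IsScalarTower.of_algebraMap_eq fun _ ↦ rfl
  haveI : Module.Free ↥A ↥B := Module.Free.of_divisionRing ↥A ↥B
  haveI : FiniteDimensional ↥A ↥B := Module.Finite.of_restrictScalars_finite K ↥A ↥B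
  -- `[B : A] = p`, `B/A` Galois, cyclic
  have hdegAB : Module.finrank ↥A ↥B = p := by
    rw [← hdeg]; exact finrank_layer_fieldRange_sup_layer κ K' hK' j' n
  haveI : IsGalois ↥A ↥B := isGalois_layer_fieldRange_sup_layer κ K' j' n
  have hcard : Nat.card (↥B ≃ₐ[↥A] ↥B) = p := by rw [IsGalois.card_aut_eq_finrank, hdegAB]
  haveI : IsCyclic (↥B ≃ₐ[↥A] ↥B) := isCyclic_of_prime_card hcard
  obtain ⟨σ, hσ⟩ := IsCyclic.exists_generator (α := ↥B ≃ₐ[↥A] ↥B)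
  have hσp : σ ^ p = 1 := by rw [← hcard]; exact pow_card_eq_one'
  -- Chevalley for odd `p` on this layer
  have hchev := padicValNat_card_fixed_add_one_le_of_odd (K := ↥A) (L := ↥B) hpr hp hdegAB hσ
  -- the action on `Cl(B)` and its fixed classes
  set f : ClassGroup (𝓞 ↥B) ≃* ClassGroup (𝓞 ↥B) := ClassGroup.mulEquiv (intAut σ) with hf
  have hfixed : Nat.card {c : ClassGroup (𝓞 ↥B) // ∀ τ : ↥B ≃ₐ[↥A] ↥B, ClassGroup.mulEquiv (intAut τ) c = c} =
      Nat.card (f.toMonoidHom.eqLocus (MonoidHom.id _)) :=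
    natCard_fixed_eq_natCard_eqLocus_of_generator (fun τ : ↥B ≃ₐ[↥A] ↥B ↦ ClassGroup.mulEquiv (intAut τ))
      mulEquiv_intAut_one mulEquiv_intAut_mul hσ
  have hff : ∀ b : ClassGroup (𝓞 ↥B), (⇑f.toMonoidHom)^[p] b = b := fun b ↦ by
    rw [hf, iterate_mulEquiv_intAut_eq_pow, hσp, mulEquiv_intAut_one, MulEquiv.refl_apply]
  -- module (G): the rank bound
  have hNj : ∀ a : ClassGroup (𝓞 ↥A), classGroupNorm ↥A ↥B (classGroupExtend ↥A ↥B a) = a ^ p := fun a ↦ by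
    rw [classGroupNorm_classGroupExtend, hdegAB]
  have hjfix : ∀ a : ClassGroup (𝓞 ↥A), f.toMonoidHom (classGroupExtend ↥A ↥B a) = classGroupExtend ↥A ↥B a :=
    fun a ↦ by rw [MulEquiv.coe_toMonoidHom, hf, mulEquiv_intAut_classGroupExtend]
  have hfix : padicValNat p (Nat.card (f.toMonoidHom.eqLocus (MonoidHom.id _))) ≤
      padicValNat p (Nat.card (ClassGroup (𝓞 ↥A))) + T := by
    rw [← hfixed]
    have hcl : classNumber ↥A = Nat.card (ClassGroup (𝓞 ↥A)) := by
      rw [classNumber, Nat.card_eq_fintype_card]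
    rw [← hcl]
    have htn : {v : HeightOneSpectrum (𝓞 ↥A) | v.asIdeal.ramificationIdxIn (𝓞 ↥B) ≠ 1}.ncard ≤ T := hram
    omega
  have hrank := padicValNat_card_quotient_le_of_fixed p f.toMonoidHom hff (classGroupExtend ↥A ↥B)
    (classGroupNorm ↥A ↥B) hNj hjfix T hfix
  -- transport to the layers of the restricted tower
  rw [classGroupPRank_restrict_eq κ K' hK' j' n, classGroupPRank_def]
  exact hrank

/-- **Iwasawa 1973, Theorem 2 (odd `ℓ`): `μ = 0` ascends a cyclic extension of odd prime degree.**  `K` a number field, `p`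
odd, `κ` a `ℤ_p`-extension of `K`, `K'/K` Galois of degree `p` with `κ ∘ res_{K'/K}` onto (`K' ∩ K_∞ = K`), `j' : K' → K̄` over
`K`; if for every `n` at most `T` primes of `K_n` ramify in `j'(K')·K_n`, then `ClassicalMuVanishes κ ⟹ ClassicalMuVanishes (κ|_{K'})`
(growth form of `μ = 0`; per layer `rank_p Cl((K'K_∞)_n) ≤ p(2R + T)`).
[cite: Iwasawa1973MuInvariants, Thm. 2 (ℓ odd) and §2 (proof)] [cite: Washington1997, §13.3 Prop. 13.23]
[cite: Lang1990, Ch. 13 §4 Lemma 4.1–4.2] [cite: NeukirchANT1999, Ch. III §1 Prop. (1.6) (ii), (iv)] -/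
theorem classicalMuVanishes_restrict_of_isGalois_of_finrank_eq_of_odd (hp : p ≠ 2) (κ : ZpExtension K p) (K' : Type)
    [Field K'] [NumberField K'] [Algebra K K'] [IsGalois K K'] (hdeg : Module.finrank K K' = p)
    (hK' : Function.Surjective (κ.toContinuousMonoidHom.comp (absGaloisRestrict K K')))
    (j' : K' →ₐ[K] AlgebraicClosure K) (T : ℕ)
    (hram : ∀ n : ℕ,
      letI : Algebra ↥(κ.layer n) ↥(j'.fieldRange ⊔ κ.layer n) :=
        (IntermediateField.inclusion (le_sup_right : κ.layer n ≤ j'.fieldRange ⊔ κ.layer n)).toRingHom.toAlgebra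
      {v : HeightOneSpectrum (𝓞 ↥(κ.layer n)) |
        v.asIdeal.ramificationIdxIn (𝓞 ↥(j'.fieldRange ⊔ κ.layer n)) ≠ 1}.ncard ≤ T)
    (hμ : ClassicalMuVanishes κ) :
    ClassicalMuVanishes (κ.restrict K' hK') := by
  obtain ⟨R, hR⟩ := exists_forall_classGroupPRank_le_of_classicalMuVanishes κ hμ
  refine classicalMuVanishes_of_forall_classGroupPRank_le (κ.restrict K' hK') (B := p * (2 * R + T)) fun n ↦ ?_
  calc classGroupPRank (κ.restrict K' hK') n ≤ p * (2 * classGroupPRank κ n + T) :=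
        classGroupPRank_restrict_le_of_isGalois_of_finrank_eq_of_odd hp κ K' hdeg hK' j' n T (hram n)
    _ ≤ p * (2 * R + T) := Nat.mul_le_mul_left _ (Nat.add_le_add_right (Nat.mul_le_mul_left 2 (hR n)) T)

end Literature.NumberTheory.IwasawaTheory

end
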